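import Mathlib
import Summits.Ventures.HodgeRepro.Tier3UnramifiedCofinite

/-!
# Tier 3 (T3.2 / T3.5) — every finite-index (⇔ open) subgroup of `ℤ_p` IS `pⁿℤ_p`

Companion of `Tier3UnramifiedCofinite` (v2, the tree): the identification that file left to the
reader (proofs/t3-p3/R2-PINNING-ADDENDUM-4.md §A20 (3): the inertia image `I_𝔓 ⊂ Γ_𝔭 ≅ ℤ_p` is an
OPEN subgroup, «hence `= pⁿΓ_𝔭` for one `n`»), made exact on the line `ℤ_p`:

* a finite-index additive subgroup `H ⊂ ℤ_p` contains `[ℤ_p : H] • ℤ_p = p^k ℤ_p` with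
  `k = v_p([ℤ_p : H])` (`AddSubgroup.nsmul_index_mem`; the prime-to-`p` part of the index is a
  unit of `ℤ_p`);
* it is then an IDEAL: `a = appr a k + p^k b` (`PadicInt.appr_spec`), so `a • x ∈ H` for
  `x ∈ H`;
* the non-zero ideals of the discrete valuation ring `ℤ_p` are the `(p^n)`
  (`PadicInt.ideal_eq_span_pow_p`) — so `H = pⁿℤ_p`, `[ℤ_p : H] = pⁿ`, and `H` is open.

With `Tier3UnramifiedCofinite.finiteIndex_of_isOpen` the three conditions on an additive
subgroup of `ℤ_p` — open, of finite index, `= pⁿℤ_p` for some `n` — coincide; EXACTLY `pⁿ`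
characters of the line (over `ℂ`) are trivial on it (`nat_card_padicInt_le_ker_span_pow`);
and the `n`-free statements of that file lose nothing.

Imports: Mathlib + the cell's `Tier3UnramifiedCofinite` only; theorems only (no definition, no
instance); no axiom beyond the standard three.
-/

namespace Summit.Ventures.HodgeRepro.T3.PadicOpenSubgroups

open Summit.Ventures.HodgeRepro.T3.UnramifiedCofinite

section PadicClassification

variable (p : ℕ) [Fact p.Prime]

/-- A natural number prime to `p` is a unit of `ℤ_p` (its norm is `1`). -/
theorem isUnit_natCast_of_not_dvd {u : ℕ} (hu : ¬ p ∣ u) : IsUnit (u : ℤ_[p]) := by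
  rw [PadicInt.isUnit_iff, PadicInt.norm_natCast_eq_one_iff]
  exact (Fact.out : p.Prime).coprime_iff_not_dvd.mpr hu

/-- A finite-index additive subgroup `H` of `ℤ_p` contains `p^k ℤ_p` for `k` the `p`-adic
valuation of its index: `[ℤ_p : H] • x ∈ H` for every `x`, and the prime-to-`p` part of the
index is a unit of `ℤ_p`. -/
theorem exists_span_pow_le_of_finiteIndex (H : AddSubgroup ℤ_[p]) [H.FiniteIndex] :
    ∃ k : ℕ, (Ideal.span {(p : ℤ_[p]) ^ k}).toAddSubgroup ≤ H := by
  obtain ⟨k, u, hu, hk⟩ :=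
    Nat.exists_eq_pow_mul_and_not_dvd (AddSubgroup.FiniteIndex.index_ne_zero (H := H)) p
      (Fact.out : p.Prime).ne_one
  refine ⟨k, fun x hx => ?_⟩
  rw [Submodule.mem_toAddSubgroup, Ideal.mem_span_singleton'] at hx
  obtain ⟨c, rfl⟩ := hx
  obtain ⟨v, hv⟩ := isUnit_natCast_of_not_dvd p hu
  have key : c * (p : ℤ_[p]) ^ k = H.index • (((v⁻¹ : ℤ_[p]ˣ) : ℤ_[p]) * c) := by
    rw [nsmul_eq_mul, hk, Nat.cast_mul, Nat.cast_pow, ← hv]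
    calc c * (p : ℤ_[p]) ^ k
        = (p : ℤ_[p]) ^ k * ((v : ℤ_[p]) * ((v⁻¹ : ℤ_[p]ˣ) : ℤ_[p])) * c := by
          rw [Units.mul_inv, mul_one, mul_comm]
      _ = (p : ℤ_[p]) ^ k * (v : ℤ_[p]) * (((v⁻¹ : ℤ_[p]ˣ) : ℤ_[p]) * c) := by ring
  rw [key]
  exact AddSubgroup.nsmul_index_mem H _

/-- A finite-index additive subgroup of `ℤ_p` is `ℤ_p`-stable, i.e. the additive group of an
ideal: with `p^k ℤ_p ≤ H`, write `a = appr a k + (a - appr a k)` with `appr a k ∈ ℕ` and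
`a - appr a k ∈ p^k ℤ_p` (`PadicInt.appr_spec`); then `a * x = appr a k • x + (a - appr a k) * x`
lies in `H` for `x ∈ H`. -/
theorem exists_ideal_toAddSubgroup_eq_of_finiteIndex (H : AddSubgroup ℤ_[p]) [H.FiniteIndex] :
    ∃ I : Ideal ℤ_[p], I.toAddSubgroup = H := by
  obtain ⟨k, hk⟩ := exists_span_pow_le_of_finiteIndex p H
  refine ⟨{ carrier := H
            add_mem' := fun ha hb => H.add_mem ha hb
            zero_mem' := H.zero_mem
            smul_mem' := fun a x hx => ?_ }, AddSubgroup.ext fun x => Iff.rfl⟩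
  have h1 : ((PadicInt.appr a k : ℕ) : ℤ_[p]) * x ∈ H := by
    rw [← nsmul_eq_mul]
    exact H.nsmul_mem hx _
  have h2 : (a - (PadicInt.appr a k : ℕ)) * x ∈ H := by
    apply hk
    rw [Submodule.mem_toAddSubgroup]
    exact Ideal.mul_mem_right _ _ (PadicInt.appr_spec k a)
  have hax : a • x = ((PadicInt.appr a k : ℕ) : ℤ_[p]) * x + (a - (PadicInt.appr a k : ℕ)) * x := by
    rw [smul_eq_mul]
    ring
  change a • x ∈ H
  rw [hax]
  exact H.add_mem h1 h2

/-- **Classification**: every finite-index additive subgroup of `ℤ_p` is `pⁿℤ_p` for some `n`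
(it is a non-zero ideal of the discrete valuation ring `ℤ_p`). -/
theorem exists_eq_span_pow_toAddSubgroup_of_finiteIndex (H : AddSubgroup ℤ_[p]) [H.FiniteIndex] :
    ∃ n : ℕ, H = (Ideal.span {(p : ℤ_[p]) ^ n}).toAddSubgroup := by
  obtain ⟨I, hI⟩ := exists_ideal_toAddSubgroup_eq_of_finiteIndex p H
  obtain ⟨k, hk⟩ := exists_span_pow_le_of_finiteIndex p H
  have hI0 : I ≠ ⊥ := by
    intro h0
    have hmem : (p : ℤ_[p]) ^ k ∈ H := hk (by
      rw [Submodule.mem_toAddSubgroup]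
      exact Ideal.mem_span_singleton_self _)
    rw [← hI, Submodule.mem_toAddSubgroup, h0, Ideal.mem_bot] at hmem
    exact pow_ne_zero k (Nat.cast_ne_zero.mpr (Fact.out : p.Prime).ne_zero) hmem
  obtain ⟨n, hn⟩ := PadicInt.ideal_eq_span_pow_p hI0
  exact ⟨n, by rw [← hI, hn]⟩

/-- The index of a finite-index additive subgroup of `ℤ_p` is a power of `p`. -/
theorem exists_index_eq_pow_of_finiteIndex (H : AddSubgroup ℤ_[p]) [H.FiniteIndex] :
    ∃ n : ℕ, H.index = p ^ n := by
  obtain ⟨n, rfl⟩ := exists_eq_span_pow_toAddSubgroup_of_finiteIndex p H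
  exact ⟨n, index_span_pow_toAddSubgroup p n⟩

/-- The exponent is determined by the subgroup: `pⁿℤ_p = pᵐℤ_p` forces `n = m`
(compare the indices `pⁿ` and `pᵐ`). -/
theorem span_pow_toAddSubgroup_injective :
    Function.Injective (fun n : ℕ => (Ideal.span {(p : ℤ_[p]) ^ n}).toAddSubgroup) := by
  intro n m h
  have := congrArg AddSubgroup.index h
  simp only [index_span_pow_toAddSubgroup] at this
  exact Nat.pow_right_injective (Fact.out : p.Prime).two_le this

/-- `pⁿℤ_p` is open in `ℤ_p`: it contains the open ball of radius `p^(1-n)` about `0`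
(`‖x‖ < p^(1-n) ⟺ ‖x‖ ≤ p^(-n) ⟺ x ∈ pⁿℤ_p`). -/
theorem isOpen_span_pow (n : ℕ) :
    IsOpen (((Ideal.span {(p : ℤ_[p]) ^ n}).toAddSubgroup : AddSubgroup ℤ_[p]) : Set ℤ_[p]) := by
  apply AddSubgroup.isOpen_of_mem_nhds (g := 0)
  rw [Metric.mem_nhds_iff]
  refine ⟨(p : ℝ) ^ (-(n : ℤ) + 1),
    zpow_pos (by exact_mod_cast (Fact.out : p.Prime).pos) _, fun x hx => ?_⟩
  rw [mem_ball_zero_iff] at hx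
  rw [SetLike.mem_coe, Submodule.mem_toAddSubgroup, ← PadicInt.norm_le_pow_iff_mem_span_pow,
    PadicInt.norm_le_pow_iff_norm_lt_pow_add_one]
  exact hx

/-- A finite-index additive subgroup of `ℤ_p` is open (it is some `pⁿℤ_p`). -/
theorem isOpen_of_finiteIndex (H : AddSubgroup ℤ_[p]) [H.FiniteIndex] :
    IsOpen (H : Set ℤ_[p]) := by
  obtain ⟨n, rfl⟩ := exists_eq_span_pow_toAddSubgroup_of_finiteIndex p H
  exact isOpen_span_pow p n

/-- **Open ⇔ finite index** for an additive subgroup of `ℤ_p` (with v2's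
`finiteIndex_of_isOpen`). -/
theorem isOpen_iff_finiteIndex (H : AddSubgroup ℤ_[p]) :
    IsOpen (H : Set ℤ_[p]) ↔ H.FiniteIndex :=
  ⟨finiteIndex_of_isOpen p H, fun h => by
    haveI := h
    exact isOpen_of_finiteIndex p H⟩

/-- **Open ⇔ `= pⁿℤ_p` for some `n`** for an additive subgroup of `ℤ_p`. -/
theorem isOpen_iff_exists_eq_span_pow (H : AddSubgroup ℤ_[p]) :
    IsOpen (H : Set ℤ_[p]) ↔ ∃ n : ℕ, H = (Ideal.span {(p : ℤ_[p]) ^ n}).toAddSubgroup := by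
  constructor
  · intro hH
    haveI := finiteIndex_of_isOpen p H hH
    exact exists_eq_span_pow_toAddSubgroup_of_finiteIndex p H
  · rintro ⟨n, rfl⟩
    exact isOpen_span_pow p n

/-- **The sharp count for ANY open subgroup `U` of the line `Γ_𝔭 ≅ ℤ_p`** (the inertia image
`I_𝔓` as the page gives it): `U = pⁿℤ_p` for exactly one `n`, and the characters
`Multiplicative ℤ_p →* ℂˣ` trivial on `U` («`ν ∈ Ξ_𝔭` unramified at `𝔓`») are EXACTLY `pⁿ`
many — the sharp form of ADDENDUM-4 §A20 (3)'s «at most `[Γ_𝔭 : I_𝔓]`». -/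
theorem exists_nat_card_le_ker_eq_pow_of_isOpen (U : AddSubgroup ℤ_[p])
    (hU : IsOpen (U : Set ℤ_[p])) :
    ∃ n : ℕ, U = (Ideal.span {(p : ℤ_[p]) ^ n}).toAddSubgroup ∧
      Nat.card {ν : Multiplicative ℤ_[p] →* ℂˣ // U.toSubgroup ≤ ν.ker} = p ^ n := by
  obtain ⟨n, rfl⟩ := (isOpen_iff_exists_eq_span_pow p U).mp hU
  exact ⟨n, rfl, nat_card_padicInt_le_ker_span_pow p n⟩

end PadicClassification

end Summit.Ventures.HodgeRepro.T3.PadicOpenSubgroups
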